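import Summits.AnomalousDissipation.AnomalousDissipation.Theses.VirtualDissipation

/-!
# Strategy census sketch — crux `LightSteadyStatesGP` (stmt-AnomalousDissipation-15151, route VirtualDissipation)

Typed companions of `STRATEGY-CENSUS.md` (crux-strategist seat `cstrat-stmt-AnomalousDissipation-15151-b1`,
2026-08-17).  Every statement below is over existing declarations; the glue theorems are proved without
`sorry`; the only `sorry`s sit in clearly marked `stub_` signatures that the census DISCUSSES (none is
registered as a line by this seat — see the census for why).

Contents
* §0 vocabulary: `fGP`, `IsSteadyGP`, `IsOdd`, `IsCyclic` (abbreviations of the crux's own clauses; the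
  symmetry class is the one of the registered line `Lines/birth.lean`).
* §S (Strengthen) `SymmLightAllNu` (S1: light symmetric states at EVERY `ν ∈ (0,1]`) ⇒ crux, proved;
  `SymmCeilingSeq` (S3: a symmetric CEILING along a sequence) + `SymmExistsAll` (existence in the class, in
  tree modulo symmetry) ⇒ crux, proved (`crux_of_exists_ceiling`) — the census's best typed SPLIT (D2).
* §P (Decomposition, alternative glue) `ParityCut` (odd total / even heavy count of symmetric steady states
  along a sequence) ⇒ crux, proved (`crux_of_parityCut`) — the Leray–Schauder-index form of birth's wall.
* §N (Negation) the ν-uniform energy FLOOR every steady state of `f_GP` obeys (signature; the sibling crux's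
  `Disproof.energy_lower_all_steady` specialised), and the typed target of a disproof, `HeavyBelow`.
* §B first PROVABLE lemmas for the registered line `birth` (stub 1): oddness/cyclicity of the steady residual,
  symmetric Temam existence — signatures (sorried, marked `stub_`).
-/

set_option linter.dupNamespace false

noncomputable section

open Filter Set Topology MeasureTheory

namespace Summit.AnomalousDissipation.AnomalousDissipation.Cruxes.LightSteadyStatesGP.Census

open Literature.Analysis.FunctionSpaces Literature.Analysis.FunctionSpaces.Torus
open Literature.Analysis.FluidPDE Literature.Analysis.FluidPDE.Torus

/-! ## §0 Vocabulary (abbreviations of the crux's clauses) -/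

/-- The pinned Galloway–Proctor force `f_GP(x) = sin(2πx₂)e₀ + sin(2πx₀)e₁ + sin(2πx₁)e₂`, the crux's inline
expression verbatim. [folklore] -/
abbrev fGP : UnitAddTorus (Fin 3) → EuclideanSpace ℝ (Fin 3) := fun x =>
  (stokesMode (Pi.single (2 : Fin 3) (1 : ℤ)) (EuclideanSpace.single (0 : Fin 3) (1 : ℝ)) false x +
    stokesMode (Pi.single (0 : Fin 3) (1 : ℤ)) (EuclideanSpace.single (1 : Fin 3) (1 : ℝ)) false x +
    stokesMode (Pi.single (1 : Fin 3) (1 : ℤ)) (EuclideanSpace.single (2 : Fin 3) (1 : ℝ)) false x :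
    EuclideanSpace ℝ (Fin 3))

/-- `(u, p)` is a classical steady state of `NS_ν(f_GP)` — the crux's clause (constant-in-time classical
solution on `ℝ × T³`), i.e. `Torus.IsSteadyNSState ν fGP u p`. [folklore] -/
abbrev IsSteadyGP (ν : ℝ) (u : UnitAddTorus (Fin 3) → EuclideanSpace ℝ (Fin 3))
    (p : UnitAddTorus (Fin 3) → ℝ) : Prop :=
  IsClassicalNSSolutionOn Set.univ ν (fun _ => fGP) (fun _ => u) (fun _ => p)

/-- Oddness `u(−x) = −u(x)` (f_GP is odd; odd fields have zero mean; an odd Beltrami field vanishes). [folklore] -/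
abbrev IsOdd (u : UnitAddTorus (Fin 3) → EuclideanSpace ℝ (Fin 3)) : Prop := ∀ x, u (-x) = -u x

/-- Cyclic symmetry `u(x ∘ r) i = u x (r i)`, `r = finRotate 3` (the symmetry of f_GP). [folklore] -/
abbrev IsCyclic (u : UnitAddTorus (Fin 3) → EuclideanSpace ℝ (Fin 3)) : Prop :=
  ∀ (x : UnitAddTorus (Fin 3)) (i : Fin 3), u (fun k => x (finRotate 3 k)) i = u x (finRotate 3 i)

/-- The crux, by name. -/
abbrev Crux : Prop := Summit.AnomalousDissipation.AnomalousDissipation.Theses.VirtualDissipation.LightSteadyStatesGP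

/-- The vanishing sequence used by every glue below: `ν_j = 1/(j+1) ∈ (0,1]`, `ν_j → 0`. [folklore] -/
theorem seq_pos (j : ℕ) : (0 : ℝ) < 1 / ((j : ℝ) + 1) := Nat.one_div_pos_of_nat

theorem seq_le_one (j : ℕ) : 1 / ((j : ℝ) + 1) ≤ (1 : ℝ) := by
  rw [div_le_one (Nat.cast_add_one_pos j)]
  linarith [(Nat.cast_nonneg j : (0 : ℝ) ≤ j)]

/-! ## §S Strengthen -/

/-- **S1** `S⁺ = light symmetric steady states at EVERY viscosity `ν ∈ (0,1]` (not only along a sequence).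
This is what any continuation/degree argument delivers anyway (birth's composition proves exactly this `key`
step); it buys no rigidity for the proof. [folklore] -/
def SymmLightAllNu : Prop :=
  ∀ ν : ℝ, 0 < ν → ν ≤ 1 → ∃ (u : UnitAddTorus (Fin 3) → EuclideanSpace ℝ (Fin 3)) (p : UnitAddTorus (Fin 3) → ℝ),
    IsSteadyGP ν u p ∧ HasZeroMean u ∧ IsOdd u ∧ IsCyclic u ∧ ∫ x, ‖u x‖ ^ 2 ≤ 2

/-- S1 ⇒ crux (sample at `ν_j = 1/(j+1)`). [folklore] -/
theorem crux_of_symmLightAllNu : SymmLightAllNu → Crux := by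
  intro h
  choose u p hsol hmean _hodd _hcyc hE using fun j : ℕ => h (1 / ((j : ℝ) + 1)) (seq_pos j) (seq_le_one j)
  exact ⟨fun j => 1 / ((j : ℝ) + 1), u, p, fun j => ⟨seq_pos j, seq_le_one j⟩,
    tendsto_one_div_add_atTop_nhds_zero_nat, hsol, hmean, hE⟩

/-- **S3** `S⁺ = a symmetric CEILING along a sequence`: at some `ν_j → 0`, EVERY odd-cyclic mean-zero classical
steady state of `NS_{ν_j}(f_GP)` has energy `≤ 2` (∀ in place of ∃: the shape an a-priori-estimate method
would prove).  Vacuous without existence; with `SymmExistsAll` it gives the crux (`crux_of_exists_ceiling`).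
Why it buys nothing: the only a priori tools (energy identity, Poincaré, testing with `f`) give
`∫|u|² ≤ 3/(32π⁴ν²)` and `∫|u|² ≥ 3/(4π) − O(ν)`; a ν-uniform ceiling in a symmetry class is the target of the
gravest-line relaminarisation barrier minus parity, with no method behind it (census §Strengthen S3). [folklore] -/
def SymmCeilingSeq : Prop :=
  ∃ ν : ℕ → ℝ, (∀ j, 0 < ν j ∧ ν j ≤ 1) ∧ Tendsto ν atTop (𝓝 0) ∧
    ∀ j (u : UnitAddTorus (Fin 3) → EuclideanSpace ℝ (Fin 3)) (p : UnitAddTorus (Fin 3) → ℝ),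
      IsSteadyGP (ν j) u p → HasZeroMean u → IsOdd u → IsCyclic u → ∫ x, ‖u x‖ ^ 2 ≤ 2

/-- **Existence in the symmetry class at every viscosity** (Leray–Schauder/Galerkin in the closed invariant
subspace of odd-cyclic fields + Temam regularity + pressure recovery; in tree WITHOUT the symmetry clauses:
`Torus.Temam1979_exists_steadyWeakSolution_holds`, `Torus.Temam1979_steadyWeakSolution_smooth_holds`,
`Theorems…CensusInterior.exists_isSteadyNSState`; the symmetric version is routine but unwritten). [cite: Temam1979, Ch. II Thm 1.2, Prop 1.1] -/
def SymmExistsAll : Prop :=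
  ∀ ν : ℝ, 0 < ν → ∃ (u : UnitAddTorus (Fin 3) → EuclideanSpace ℝ (Fin 3)) (p : UnitAddTorus (Fin 3) → ℝ),
    IsSteadyGP ν u p ∧ HasZeroMean u ∧ IsOdd u ∧ IsCyclic u

/-- **D2, the best typed split this seat could produce**: existence in the class (known) + symmetric ceiling
along a sequence (the whole difficulty, in ∀-form) ⇒ crux.  Proved; NOT filed (census §Decomposition D2). [folklore] -/
theorem crux_of_exists_ceiling : SymmExistsAll → SymmCeilingSeq → Crux := by
  rintro hex ⟨ν, hν, hν0, hceil⟩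
  choose u p hsol hmean hodd hcyc using fun j : ℕ => hex (ν j) (hν j).1
  exact ⟨ν, u, p, hν, hν0, hsol, hmean, fun j => hceil j (u j) (p j) (hsol j) (hmean j) (hodd j) (hcyc j)⟩

/-! ## §P Decomposition — the parity (Leray–Schauder index) form of birth's wall -/

/-- The set of odd-cyclic mean-zero classical steady velocity fields of `NS_ν(f_GP)` (pressure ∃-quantified:
it is unique up to a constant, so counting velocities counts states). [folklore] -/
def steadySymmSet (ν : ℝ) : Set (UnitAddTorus (Fin 3) → EuclideanSpace ℝ (Fin 3)) :=
  {u | ∃ p : UnitAddTorus (Fin 3) → ℝ, IsSteadyGP ν u p ∧ HasZeroMean u ∧ IsOdd u ∧ IsCyclic u}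

/-- **Parity cut.**  Along some `ν_j → 0` in `(0,1]`: the symmetric steady set is finite of ODD cardinality
(generic-ν theorem shape: nondegenerate steady states counted with Leray–Schauder indices sum to `1` —
Foias–Temam 1977/1978 for generic forces; for the FIXED force f_GP only ν-genericity is available and not
re-read this session) and the HEAVY ones (`∫|u|² > 2`) are EVEN in number (the bet: heavy symmetric states
are born in fold pairs; equivalently the signed count of crossings of the level `∫|u|² = 2` above `ν_j` is not
`−1`).  Different cut from birth's wall (it tolerates paired wall crossings); same epistemic status (no method
proves the heavy-parity clause; numerics can only support it). [cite: doi:10.1002/cpa.3160300202] -/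
def ParityCut : Prop :=
  ∃ ν : ℕ → ℝ, (∀ j, 0 < ν j ∧ ν j ≤ 1) ∧ Tendsto ν atTop (𝓝 0) ∧
    ∀ j, (steadySymmSet (ν j)).Finite ∧ Odd (steadySymmSet (ν j)).ncard ∧
      Even ({u ∈ steadySymmSet (ν j) | 2 < ∫ x, ‖u x‖ ^ 2}).ncard

/-- Parity cut ⇒ crux: odd total minus even heavy leaves a light symmetric state. [folklore] -/
theorem crux_of_parityCut : ParityCut → Crux := by
  rintro ⟨ν, hν, hν0, hpar⟩
  have key : ∀ j, ∃ u ∈ steadySymmSet (ν j), ∫ x, ‖u x‖ ^ 2 ≤ 2 := by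
    intro j
    obtain ⟨hfin, hodd, heven⟩ := hpar j
    set S := steadySymmSet (ν j) with hS
    set H : Set (UnitAddTorus (Fin 3) → EuclideanSpace ℝ (Fin 3)) := {u ∈ S | 2 < ∫ x, ‖u x‖ ^ 2} with hH
    have hsub : H ⊆ S := fun u hu => hu.1
    have hsum : (S \ H).ncard + H.ncard = S.ncard := Set.ncard_sdiff_add_ncard_of_subset hsub hfin
    by_contra hno
    push Not at hno
    have hempty : S \ H = ∅ := by
      ext u
      simp only [Set.mem_sdiff, Set.mem_empty_iff_false, iff_false, not_and, not_not]
      intro hu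
      exact ⟨hu, hno u hu⟩
    rw [hempty, Set.ncard_empty, zero_add] at hsum
    rw [← hsum] at hodd
    exact (Nat.not_even_iff_odd.2 hodd) heven
  choose u hu hE using key
  choose p hsol hmean _hodd _hcyc using hu
  exact ⟨ν, u, p, hν, hν0, hsol, hmean, hE⟩

/-! ## §N Negation -/

/-- **What a disproof must deliver** (`¬ crux` unfolded): below some `ν₀ > 0`, EVERY mean-zero classical
steady state of `NS_ν(f_GP)` is heavy.  No symmetry may be assumed here. [folklore] -/
def HeavyBelow : Prop :=
  ∃ ν₀ : ℝ, 0 < ν₀ ∧ ∀ ν : ℝ, 0 < ν → ν < ν₀ →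
    ∀ (u : UnitAddTorus (Fin 3) → EuclideanSpace ℝ (Fin 3)) (p : UnitAddTorus (Fin 3) → ℝ),
      IsSteadyGP ν u p → HasZeroMean u → 2 < ∫ x, ‖u x‖ ^ 2

/-- `HeavyBelow` is exactly the negation of the crux (the crux only samples `ν ≤ 1`, and `ν₀ ≤ 1` w.l.o.g.). [folklore] -/
theorem not_crux_of_heavyBelow : HeavyBelow → ¬ Crux := by
  rintro ⟨ν₀, hν₀, hheavy⟩ ⟨ν, u, p, hν, hν0, hsol, hmean, hE⟩
  -- some ν_j lies below ν₀
  have hev : ∀ᶠ j in atTop, ν j < ν₀ := (tendsto_order.1 hν0).2 ν₀ hν₀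
  obtain ⟨j, hj⟩ := hev.exists
  exact absurd (hE j) (not_le.2 (hheavy (ν j) (hν j).1 hj (u j) (p j) (hsol j) (hmean j)))

theorem heavyBelow_of_not_crux : ¬ Crux → HeavyBelow := by
  intro h
  by_contra hH
  apply h
  -- no ν₀ works: at every level 1/(j+1) there is a light mean-zero steady state below it
  simp only [HeavyBelow, not_exists, not_and, not_forall, not_lt, exists_prop] at hH
  choose ν hνpos hνlt u p hsol hmean hE using fun j : ℕ => hH (1 / ((j : ℝ) + 1)) (seq_pos j)
  refine ⟨ν, u, p, fun j => ⟨hνpos j, (hνlt j).le.trans (seq_le_one j)⟩, ?_, hsol, hmean, hE⟩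
  exact squeeze_zero (fun j => (hνpos j).le) (fun j => (hνlt j).le) tendsto_one_div_add_atTop_nhds_zero_nat

/-- **The only coercive handle in the disproof direction: a ν-uniform energy FLOOR, not a ceiling.**  Testing
the steady equation with `w = f_GP` (`‖f_GP‖² = 3/2`, `sup‖Df_GP‖ = 2π`, `‖Δf_GP‖² = 24π⁴` on the unit torus)
gives `3/2 ≤ (2π + ν/2)∫|u|² + 12π⁴ν` for EVERY classical steady state (any mean, any symmetry), i.e.
`∫|u|² ≥ (3/2 − 12π⁴ν)/(2π + ν/2) → 3/(4π) ≈ 0.239`: light states are confined to the shell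
`0.239 ≤ ∫|u|² ≤ 2`, and nothing known pushes the floor to `2`.  Signature only here; it is the sibling crux's
PROVED `Cruxes/SteadyStatesLoudBounded/Disproof.energy_lower_all_steady` / `norm_sq_force_le` specialised to
`f_GP` (not imported into this sketch). [folklore] -/
theorem stub_energyFloorGP :
    ∀ (ν : ℝ) (u : UnitAddTorus (Fin 3) → EuclideanSpace ℝ (Fin 3)) (p : UnitAddTorus (Fin 3) → ℝ),
      0 ≤ ν → IsSteadyGP ν u p →
        (3 : ℝ) / 2 ≤ (2 * Real.pi + ν / 2) * (∫ x, ‖u x‖ ^ 2) + 12 * Real.pi ^ 4 * ν := by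
  sorry

/-- **The typed obstruction a counterexample would need** ("super-Onsager rigidity" of f_GP in the light ball):
residual bounds `R → 0` force virtual dissipation `R‖∇U‖₂ → ∞` (not merely `≥ c`, which is the sibling crux
`LambRigidGP` and only makes light states LOUD).  With it, a light steady state (`R = ν‖∇u‖`, `R‖∇u‖ = ν‖∇u‖²
= (f_GP,u) ≤ √3`) is impossible at small ν, i.e. `HeavyBelow`.  It is the NEGATION of frozen turbulence for
f_GP in steady form and has no method behind it; recorded, not registered (census §Negation N1). [folklore] -/
def SuperRigidGP : Prop :=
  ∀ K : ℝ, ∃ δ : ℝ, 0 < δ ∧ ∀ u : UnitAddTorus (Fin 3) → EuclideanSpace ℝ (Fin 3), IsSmooth u → IsDivFree u →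
    HasZeroMean u → ∫ x, ‖u x‖ ^ 2 ≤ 2 → ∀ R : ℝ, 0 < R → R ≤ δ →
      (∀ w : UnitAddTorus (Fin 3) → EuclideanSpace ℝ (Fin 3), IsSmooth w → IsDivFree w → HasZeroMean w →
        |∫ x, inner ℝ (convect u u x - fGP x) (w x)| ≤ R * Real.sqrt (gradNormSq w)) →
      K ≤ R * Real.sqrt (gradNormSq u)


/-! ## §B First provable lemmas for the registered line `birth` (its stub 1, the continuum in `V_sym`)

Signatures only (marked `stub_`, sorried): the equivariance facts that make `V_sym` an invariant subspace of the
steady map, and symmetric existence.  Sizes M / M / L; all force-agnostic except through `fGP`'s own symmetry. -/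

/-- The steady residual `ν Δu − (u·∇)u + f_GP` of an ODD smooth field is odd (chain rule under `x ↦ −x`:
`Δ` and `f_GP` preserve oddness, `(u·∇)u` of an odd field is odd). First lemma toward the invariance of `V_sym`. [folklore] -/
theorem stub_residual_odd (ν : ℝ) (u : UnitAddTorus (Fin 3) → EuclideanSpace ℝ (Fin 3)) (hu : IsSmooth u)
    (hodd : IsOdd u) :
    ∀ x, ν • laplacian u (-x) - convect u u (-x) + fGP (-x) = -(ν • laplacian u x - convect u u x + fGP x) := by
  sorry

/-- The steady residual of a CYCLIC smooth field is cyclic (chain rule under the coordinate rotation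
`x ↦ x ∘ finRotate 3` composed with the matching rotation of components; `f_GP` is cyclic by inspection). [folklore] -/
theorem stub_residual_cyclic (ν : ℝ) (u : UnitAddTorus (Fin 3) → EuclideanSpace ℝ (Fin 3)) (hu : IsSmooth u)
    (hcyc : IsCyclic u) :
    ∀ (x : UnitAddTorus (Fin 3)) (i : Fin 3),
      (ν • laplacian u (fun k => x (finRotate 3 k)) - convect u u (fun k => x (finRotate 3 k)) +
          fGP (fun k => x (finRotate 3 k))) i =
        (ν • laplacian u x - convect u u x + fGP x) (finRotate 3 i) := by
  sorry

/-- **Symmetric Temam existence** (`SymmExistsAll` as a stub): Galerkin/Leray–Schauder run inside the closed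
invariant subspace of odd-cyclic solenoidal fields, then Temam regularity and pressure recovery as in
`Theorems…CensusInterior.exists_isSteadyNSState`. Size L. [cite: Temam1979, Ch. II Thm 1.2, Prop 1.1] -/
theorem stub_symmExistsAll : SymmExistsAll := by
  sorry

end Summit.AnomalousDissipation.AnomalousDissipation.Cruxes.LightSteadyStatesGP.Census

end
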